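import Mathlib
import Summits.PneNP.PneNP.Theorems.ConvexRankGatesConvexGateBlindAffinePencilSixData

/-!
# PneNP / ConvexRankGates — `ConvexGateBlind`: the six-dimensional exclusion construction — bounds and the clique `S ∪ {a,b}`

Helpers (`--supports stmt-PneNP-10680`), COLUMN-SPACE line (prover seat 2, session 26), PSD side; PROPOSITION L of memo
ANALYSIS-seat2-s26 §2.3, between the data (`…SixData.lean`) and the validity proof (`…SixValid.lean`):

* numerical bounds on the constants — `A ≥ ½`, `A² ≥ A₂ ≥ ⟨w(u), w(u)⟩` (the spoke vector of every graph is dominated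
  coordinatewise by the total spoke vector: moment-curve coordinates are non-negative), `1 ≤ κ ≤ 2`, `|c_e| ≤ C₁`,
  `θ₀ > 0` and `⟨nvec e, nvec e'⟩ ≤ 1 − θ₀` for distinct rims, `L ≥ 1` dominating its summands (`six_pencil_data`);
* the combinatorial heart — `cliqueFn_true_of_superset`: core complete + rim `{a,b}` on + all `2(k−2)` spokes from `a, b`
  to `S` on ⟹ `u` contains the `k`-clique `S ∪ {a,b}`; hence a clique-free graph misses a spoke (`exists_missing_spoke`)
  and has `#spokes(a) + #spokes(b) ≤ 2(k−2) − 1` (`card_spokesAt_add_le`). [new]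
-/

set_option linter.dupNamespace false

namespace Summit.PneNP.PneNP.Theorems

open Finset Real Matrix Literature.Computability.Complexity
open Summit.PneNP.PneNP.Cruxes.ConvexGateBlind.StrictRankConicCover (Edge cdist)

noncomputable section

namespace SixPencil

variable {m : ℕ}

/-! ## Basic bounds -/

/-- `A₂ ≥ 0`. [folklore] -/
theorem A2_nonneg (S : Finset (Fin m)) (k : ℕ) : 0 ≤ A2 S k := by
  rw [A2, dotProduct]; exact Finset.sum_nonneg fun i _ => mul_self_nonneg _

/-- `A ≥ ½ > 0`. [folklore] -/
theorem Abud_pos (S : Finset (Fin m)) (k : ℕ) : 0 < Abud S k := by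
  have := A2_nonneg S k; rw [Abud]; linarith

/-- `A² ≥ A₂` (AM–GM, root-free). [folklore] -/
theorem A2_le_Abud_sq (S : Finset (Fin m)) (k : ℕ) : A2 S k ≤ Abud S k ^ 2 := by
  rw [Abud]; nlinarith [sq_nonneg (A2 S k - 1)]

/-- **The spoke vector of a graph is dominated by the total spoke vector**: `0 ≤ w(u)ᵢ ≤ Vᵢ` (for `k ≥ 3`). [new] -/
theorem wvec_le_Vtot (S : Finset (Fin m)) {k : ℕ} (hk : 3 ≤ k) (u : Edge m → Bool) (i : Fin 5) :
    0 ≤ wvec S k u i ∧ wvec S k u i ≤ Vtot S k i := by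
  have hk' : (0 : ℝ) ≤ 1 / ((k : ℝ) - 2) := by
    have : (3 : ℝ) ≤ k := by exact_mod_cast hk
    exact div_nonneg one_pos.le (by linarith)
  have hterm : ∀ e : Edge m, 0 ≤ ((1 / ((k : ℝ) - 2)) • spokeVec S e) i := fun e => by
    simp only [Pi.smul_apply, smul_eq_mul]; exact mul_nonneg hk' (spokeVec_nonneg S e i)
  simp only [wvec, Vtot, Finset.sum_apply]
  refine ⟨Finset.sum_nonneg fun e _ => hterm e, ?_⟩
  refine Finset.sum_le_sum_of_subset_of_nonneg (fun e he => ?_) fun e _ _ => hterm e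
  simp only [onCls, mem_filter, mem_univ, true_and] at he ⊢
  exact he.2

/-- `⟨w(u), w(u)⟩ ≤ A₂`. [new] -/
theorem wvec_dotProduct_self_le (S : Finset (Fin m)) {k : ℕ} (hk : 3 ≤ k) (u : Edge m → Bool) :
    wvec S k u ⬝ᵥ wvec S k u ≤ A2 S k := by
  rw [A2, dotProduct, dotProduct]
  refine Finset.sum_le_sum fun i _ => ?_
  obtain ⟨h0, h1⟩ := wvec_le_Vtot S hk u i
  exact mul_le_mul h1 h1 h0 (h0.trans h1)

/-- `dotNorm w(u) ≤ A`. [new] -/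
theorem dotNorm_wvec_le (S : Finset (Fin m)) {k : ℕ} (hk : 3 ≤ k) (u : Edge m → Bool) :
    dotNorm (wvec S k u) ≤ Abud S k :=
  dotNorm_le_of_dotProduct_self_le_sq (Abud_pos S k).le ((wvec_dotProduct_self_le S hk u).trans (A2_le_Abud_sq S k))

/-- `1 ≤ κ ≤ 2` for `k ≥ 3`. [folklore] -/
theorem kap_bounds {k : ℕ} (hk : 3 ≤ k) : 1 ≤ kap k ∧ kap k ≤ 2 := by
  have : (3 : ℝ) ≤ k := by exact_mod_cast hk
  have h1 : 0 < 2 * ((k : ℝ) - 2) := by linarith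
  have h2 : 1 / (2 * ((k : ℝ) - 2)) ≤ 1 := by rw [div_le_one h1]; linarith
  have h3 : 0 ≤ 1 / (2 * ((k : ℝ) - 2)) := by positivity
  rw [kap]; constructor <;> linarith

/-- `|c_e| ≤ C₁`. [new] -/
theorem abs_cc_le (S : Finset (Fin m)) {k : ℕ} (hk : 3 ≤ k) (e : Edge m) : |cc S k e| ≤ C1 S k := by
  obtain ⟨hk1, hk2⟩ := kap_bounds hk
  have he0 := etaE_pos e
  have he1 := etaE_le_one e
  have hA := Abud_pos S k
  have hke : kap k * etaE e ≤ 2 := by nlinarith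
  have hke0 : 0 ≤ kap k * etaE e := by nlinarith
  rw [cc, C1, abs_le]; constructor <;> linarith

/-- `Etot` bounds the cardinality of every edge set. [folklore] -/
theorem card_le_Etot (T : Finset (Edge m)) : (T.card : ℝ) ≤ Etot m := by
  rw [Etot]; exact_mod_cast Finset.card_le_univ T

/-- `0 ≤ Etot`. [folklore] -/
theorem Etot_nonneg (m : ℕ) : 0 ≤ Etot m := Nat.cast_nonneg _

/-- **The angular gap is positive.** [new] -/
theorem theta0_pos (S : Finset (Fin m)) : 0 < theta0 S := by
  rw [theta0]
  split_ifs with h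
  · rw [Finset.lt_inf'_iff]
    intro p hp
    simp only [rimPairs, mem_filter] at hp
    have hlt := dotProduct_lt_one_of_ne (nvec_unit p.1) (nvec_unit p.2) (fun heq => hp.2 (nvec_injective heq))
    linarith
  · exact one_pos

/-- `θ₀ ≤ 2`. [folklore] -/
theorem theta0_le_two (S : Finset (Fin m)) : theta0 S ≤ 2 := by
  rw [theta0]
  split_ifs with h
  · obtain ⟨p, hp⟩ := h
    refine (Finset.inf'_le _ hp).trans ?_
    have h1 := dotProduct_le_dotNorm_mul_dotNorm (nvec p.1) (-(nvec p.2))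
    rw [dotProduct_neg] at h1
    have hn : dotNorm (-(nvec p.2)) = 1 := by
      rw [show dotNorm (-(nvec p.2)) = dotNorm (nvec p.2) by simp [dotNorm]]; exact dotNorm_eq_one_of_unit (nvec_unit _)
    rw [dotNorm_eq_one_of_unit (nvec_unit _), hn] at h1
    linarith
  · norm_num

/-- **Distinct rims are separated by the gap**: `⟨nvec e, nvec e'⟩ ≤ 1 − θ₀`. [new] -/
theorem nvec_dot_le (S : Finset (Fin m)) {e e' : Edge m} (he : cls S e = 0) (he' : cls S e' = 0) (hne : e ≠ e') :
    nvec e ⬝ᵥ nvec e' ≤ 1 - theta0 S := by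
  have hp : (e, e') ∈ rimPairs S := by
    simp only [rimPairs, rims, mem_filter, mem_product, mem_univ, true_and]; exact ⟨⟨he, he'⟩, hne⟩
  have hne' : (rimPairs S).Nonempty := ⟨_, hp⟩
  rw [theta0, dif_pos hne']
  have := Finset.inf'_le (fun p : Edge m × Edge m => 1 - nvec p.1 ⬝ᵥ nvec p.2) hp
  linarith

/-- `ν_e ≤ ν_tot`. [folklore] -/
theorem nuE_le_nutot (e : Edge m) : nuE e ≤ nutot m := by
  rw [nutot]
  exact Finset.single_le_sum (fun f _ => zero_le_one.trans (one_le_nuE f)) (mem_univ e)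

/-- `L ≥ 1`, and `L` dominates its two summands. [new] -/
theorem Lbig_bounds (S : Finset (Fin m)) {k : ℕ} (hk : 3 ≤ k) :
    1 ≤ Lbig S k ∧ ((k : ℝ) - 2) * A2 S k * nutot m ≤ Lbig S k ∧ 2 * Etot m * C1 S k / theta0 S ≤ Lbig S k := by
  have h3 : (3 : ℝ) ≤ k := by exact_mod_cast hk
  have hA2 := A2_nonneg S k
  have hnu : 0 ≤ nutot m := Finset.sum_nonneg fun f _ => zero_le_one.trans (one_le_nuE f)
  have hC1 : 0 ≤ C1 S k := by have := Abud_pos S k; rw [C1]; linarith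
  have ht := theta0_pos S
  have hE := Etot_nonneg m
  have h1 : 0 ≤ ((k : ℝ) - 2) * A2 S k * nutot m := by apply mul_nonneg (mul_nonneg (by linarith) hA2) hnu
  have h2 : 0 ≤ 2 * Etot m * C1 S k / theta0 S := div_nonneg (mul_nonneg (mul_nonneg two_pos.le hE) hC1) ht.le
  refine ⟨?_, ?_, ?_⟩ <;> simp only [Lbig] <;> linarith


/-! ## Edges from vertex pairs -/

/-- The edge `{a, b}` of `K_m`. [folklore] -/
def mkEdge {a b : Fin m} (hab : a ≠ b) : Edge m := ⟨s(a, b), by simpa using hab⟩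

/-- `edgeVerts {a,b} = {a,b}`. [folklore] -/
theorem edgeVerts_mkEdge {a b : Fin m} (hab : a ≠ b) : edgeVerts (mkEdge hab) = {a, b} := edgeVerts_mk hab

/-- `{b,a} = {a,b}`. [folklore] -/
theorem mkEdge_comm {a b : Fin m} (hab : a ≠ b) : mkEdge hab.symm = mkEdge hab :=
  Subtype.ext Sym2.eq_swap

/-- An edge with vertex set `{a,b}` is `mkEdge`. [folklore] -/
theorem eq_mkEdge_of_edgeVerts_eq {e : Edge m} {a b : Fin m} (hab : a ≠ b) (he : edgeVerts e = {a, b}) :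
    e = mkEdge hab :=
  edgeVerts_injective (by rw [he, edgeVerts_mkEdge])

/-- Adjacency in `cliqueGraph u` is `u {a,b} = true`. [folklore] -/
theorem adj_iff_mkEdge (u : Edge m → Bool) {a b : Fin m} (hab : a ≠ b) :
    (cliqueGraph u).Adj a b ↔ u (mkEdge hab) = true := by
  rw [cliqueGraph_adj]
  exact ⟨fun ⟨_, h⟩ => h, fun h => ⟨hab, h⟩⟩

/-- A pair inside `S` is a core edge. [folklore] -/
theorem cls_mkEdge_of_mem (S : Finset (Fin m)) {x y : Fin m} (hxy : x ≠ y) (hx : x ∈ S) (hy : y ∈ S) :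
    cls S (mkEdge hxy) = 2 := by
  rw [cls, edgeVerts_mkEdge, Finset.inter_eq_left.2, card_pair hxy]
  intro v hv
  rw [mem_insert, mem_singleton] at hv
  rcases hv with rfl | rfl <;> assumption

/-! ## The clique `S ∪ {a, b}` -/

/-- **If the core is complete, the rim `{a,b}` is on and all `2(k−2)` spokes from `a, b` to `S` are on, then `u` has the
`k`-clique `S ∪ {a,b}`.** [new] -/
theorem cliqueFn_true_of_superset {k : ℕ} (hk : 3 ≤ k) {S : Finset (Fin m)} (hS : S.card = k - 2) {a b : Fin m}
    (ha : a ∉ S) (hb : b ∉ S) (hab : a ≠ b) (u : Edge m → Bool) (hcore : ∀ e : Edge m, cls S e = 2 → u e = true)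
    (hspa : ∀ (s : Fin m) (hs : s ∈ S), u (mkEdge (ne_of_mem_of_not_mem hs ha)) = true)
    (hspb : ∀ (s : Fin m) (hs : s ∈ S), u (mkEdge (ne_of_mem_of_not_mem hs hb)) = true)
    (hrim : u (mkEdge hab) = true) : cliqueFn m k u = true := by
  classical
  by_contra hne
  have hfalse : cliqueFn m k u = false := by simpa using hne
  rw [cliqueFn_eq_false_iff] at hfalse
  set Q : Finset (Fin m) := insert a (insert b S) with hQ
  have hcard : Q.card = k := by
    rw [hQ, card_insert_of_notMem (by simp [hab, ha]), card_insert_of_notMem hb, hS]; omega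
  -- every pair of `Q` is on
  have hon : ∀ (x y : Fin m) (hxy : x ≠ y), x ∈ Q → y ∈ Q → u (mkEdge hxy) = true := by
    intro x y hxy hx hy
    rw [hQ, mem_insert, mem_insert] at hx hy
    rcases hx with rfl | rfl | hx
    · rcases hy with rfl | rfl | hy
      · exact absurd rfl hxy
      · exact hrim
      · rw [← mkEdge_comm]; exact hspa y hy
    · rcases hy with rfl | rfl | hy
      · rw [← mkEdge_comm]; exact hrim
      · exact absurd rfl hxy
      · rw [← mkEdge_comm]; exact hspb y hy
    · rcases hy with rfl | rfl | hy
      · exact hspa x hx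
      · exact hspb x hx
      · exact hcore _ (cls_mkEdge_of_mem S hxy hx hy)
  have hclique : (cliqueGraph u).IsNClique k Q := by
    refine ⟨fun x hx y hy hxy => (adj_iff_mkEdge u hxy).2 (hon x y hxy hx hy), hcard⟩
  exact hfalse Q hclique

/-- **A clique-free graph misses a spoke**: core complete, rim `{a,b}` on, `u` clique-free ⟹ some spoke from `a` or from `b`
to `S` is off. [new] -/
theorem exists_missing_spoke {k : ℕ} (hk : 3 ≤ k) {S : Finset (Fin m)} (hS : S.card = k - 2) {a b : Fin m}
    (ha : a ∉ S) (hb : b ∉ S) (hab : a ≠ b) {u : Edge m → Bool} (hu : cliqueFn m k u = false)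
    (hcore : ∀ e : Edge m, cls S e = 2 → u e = true) (hrim : u (mkEdge hab) = true) :
    ∃ (s : Fin m) (hs : s ∈ S), u (mkEdge (ne_of_mem_of_not_mem hs ha)) = false ∨
      u (mkEdge (ne_of_mem_of_not_mem hs hb)) = false := by
  by_contra hall
  push Not at hall
  have h := cliqueFn_true_of_superset hk hS ha hb hab u hcore
    (fun s hs => by simpa using (hall s hs).1) (fun s hs => by simpa using (hall s hs).2) hrim
  rw [hu] at h
  exact Bool.false_ne_true h

/-! ## Spokes of a graph at an outer vertex -/

/-- The spokes of `u` through the outer vertex `a`. [new] -/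
def spokesAt (S : Finset (Fin m)) (u : Edge m → Bool) (a : Fin m) : Finset (Edge m) :=
  (onCls S u 1).filter fun e => a ∈ edgeVerts e

/-- A spoke through the outer vertex `a` is `{s, a}` for some `s ∈ S`. [folklore] -/
theorem exists_eq_mkEdge_of_mem_spokesAt {S : Finset (Fin m)} {u : Edge m → Bool} {a : Fin m} (ha : a ∉ S)
    {e : Edge m} (he : e ∈ spokesAt S u a) :
    ∃ (s : Fin m) (hs : s ∈ S), e = mkEdge (ne_of_mem_of_not_mem hs ha) := by
  simp only [spokesAt, onCls, mem_filter, mem_univ, true_and] at he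
  obtain ⟨⟨-, hcls⟩, hae⟩ := he
  obtain ⟨x, y, hxy, hexy⟩ := exists_edgeVerts_eq_pair e
  -- the other endpoint `s`
  have key : ∀ s : Fin m, s ≠ a → edgeVerts e = {a, s} → ∃ (s' : Fin m) (hs' : s' ∈ S),
      e = mkEdge (ne_of_mem_of_not_mem hs' ha) := by
    intro s hsa hes
    have hsS : s ∈ S := by
      by_contra hsS
      have : edgeVerts e ∩ S = ∅ := by
        rw [hes]; ext v; simp only [mem_inter, mem_insert, mem_singleton, Finset.notMem_empty, iff_false, not_and]
        rintro (rfl | rfl) <;> assumption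
      rw [cls, this, card_empty] at hcls; exact absurd hcls (by norm_num)
    refine ⟨s, hsS, ?_⟩
    rw [← mkEdge_comm]
    exact eq_mkEdge_of_edgeVerts_eq _ hes
  rw [hexy, mem_insert, mem_singleton] at hae
  rcases hae with rfl | rfl
  · exact key y hxy.symm hexy
  · rw [pair_comm] at hexy; exact key x hxy hexy

/-- At most `k − 2` spokes through an outer vertex. [new] -/
theorem card_spokesAt_le {k : ℕ} {S : Finset (Fin m)} (hS : S.card = k - 2) (u : Edge m → Bool) {a : Fin m} (ha : a ∉ S) :
    (spokesAt S u a).card ≤ k - 2 := by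
  classical
  have hsub : spokesAt S u a ⊆ S.attach.image fun s => mkEdge (ne_of_mem_of_not_mem s.2 ha) := by
    intro e he
    obtain ⟨s, hs, rfl⟩ := exists_eq_mkEdge_of_mem_spokesAt ha he
    exact mem_image.2 ⟨⟨s, hs⟩, mem_attach _ _, rfl⟩
  refine (card_le_card hsub).trans ?_
  refine card_image_le.trans ?_
  rw [card_attach, hS]

/-- With a missing spoke `{s₀, a}`, at most `k − 3` spokes through `a`. [new] -/
theorem card_spokesAt_le_of_missing {k : ℕ} {S : Finset (Fin m)} (hS : S.card = k - 2) (u : Edge m → Bool) {a : Fin m}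
    (ha : a ∉ S) {s₀ : Fin m} (hs₀ : s₀ ∈ S) (hoff : u (mkEdge (ne_of_mem_of_not_mem hs₀ ha)) = false) :
    (spokesAt S u a).card + 1 ≤ k - 2 := by
  classical
  set img := S.attach.image fun s => mkEdge (ne_of_mem_of_not_mem s.2 ha) with himg
  have he₀ : mkEdge (ne_of_mem_of_not_mem hs₀ ha) ∈ img := mem_image.2 ⟨⟨s₀, hs₀⟩, mem_attach _ _, rfl⟩
  have hsub : spokesAt S u a ⊆ img.erase (mkEdge (ne_of_mem_of_not_mem hs₀ ha)) := by
    intro e he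
    have he' := he
    simp only [spokesAt, onCls, mem_filter, mem_univ, true_and] at he'
    obtain ⟨s, hs, rfl⟩ := exists_eq_mkEdge_of_mem_spokesAt ha he
    refine mem_erase.2 ⟨fun heq => ?_, mem_image.2 ⟨⟨s, hs⟩, mem_attach _ _, rfl⟩⟩
    rw [heq, hoff] at he'
    exact Bool.false_ne_true he'.1.1
  have h1 := card_le_card hsub
  rw [card_erase_of_mem he₀] at h1
  have h2 : img.card ≤ k - 2 := card_image_le.trans (by rw [card_attach, hS])
  have h3 : 0 < img.card := card_pos.2 ⟨_, he₀⟩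
  omega

/-- **Clique-free ⟹ short on spokes**: core complete, rim `{a,b}` on, `u` `k`-clique-free ⟹
`#spokes(a) + #spokes(b) ≤ 2(k−2) − 1`. [new] -/
theorem card_spokesAt_add_le {k : ℕ} (hk : 3 ≤ k) {S : Finset (Fin m)} (hS : S.card = k - 2) {a b : Fin m}
    (ha : a ∉ S) (hb : b ∉ S) (hab : a ≠ b) {u : Edge m → Bool} (hu : cliqueFn m k u = false)
    (hcore : ∀ e : Edge m, cls S e = 2 → u e = true) (hrim : u (mkEdge hab) = true) :
    (spokesAt S u a).card + (spokesAt S u b).card + 1 ≤ 2 * (k - 2) := by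
  obtain ⟨s, hs, hoff | hoff⟩ := exists_missing_spoke hk hS ha hb hab hu hcore hrim
  · have h1 := card_spokesAt_le_of_missing hS u ha hs hoff
    have h2 := card_spokesAt_le hS u hb
    omega
  · have h1 := card_spokesAt_le hS u ha
    have h2 := card_spokesAt_le_of_missing hS u hb hs hoff
    omega

end SixPencil

/-- **The construction data** (registered form): for `k ≥ 3` the spoke vector of every graph has length at most the base
budget `A`, every rim constant is at most `C₁` in absolute value, and distinct rims have unit normals at inner product at most
`1 − θ₀` with `θ₀ > 0`. [new] -/
theorem six_pencil_data : ∀ {m : ℕ} (S : Finset (Fin m)) {k : ℕ}, 3 ≤ k → (∀ u : Edge m → Bool, dotNorm (SixPencil.wvec S k u) ≤ SixPencil.Abud S k) ∧ (∀ e : Edge m, |SixPencil.cc S k e| ≤ SixPencil.C1 S k) ∧ 0 < SixPencil.theta0 S ∧ (∀ e e' : Edge m, SixPencil.cls S e = 0 → SixPencil.cls S e' = 0 → e ≠ e' → SixPencil.nvec e ⬝ᵥ SixPencil.nvec e' ≤ 1 - SixPencil.theta0 S) :=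
  fun S _ hk => ⟨fun u => SixPencil.dotNorm_wvec_le S hk u, fun e => SixPencil.abs_cc_le S hk e, SixPencil.theta0_pos S,
    fun _ _ he he' hne => SixPencil.nvec_dot_le S he he' hne⟩

end

end Summit.PneNP.PneNP.Theorems
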